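import Summits.QuantumFields.Balaban3D.Proofs.Inputs
import Summits.QuantumFields.Balaban3D.Proofs.StandardAC

/-!
# `Summit.QuantumFields.Balaban3D.Proofs.InputsAC` — the lane's END-THEOREM ADAPTERS over the AC tower: seat p3's `Proofs.Inputs` §1/§2b/§3
# (`inputOf`/`towerOf`/`pieces`/`mkT`, the unpinned `towerW`/`piecesW` and the (55)/(57) pin transfers, the bookkeeping leaves C9 `starCount`,
# C13 `ztermSucc`, C14 `rmSucc`) twinned for `StandardAC.ExternalInputsAC` (averaging only `AvgAC`) and the UNCAPPED masses — lane
# `pub-balaban3d`, seat alpha-1 (definition request `defn-AlphaInputsT3AC` of route `UnitScaleTilt`, cell ym3-torus)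

The constants record `Inputs.LaneConsts`, the chart spaces `Inputs.ChartSpace`, the step-piece parameters `Carriers.piecesParamsOf`, the
block counts `nblkOf` and every leaf PROVIDER used below (`StarCountRun3.starCount_leaf_run3`, `Run3Zterm.ztermSucc_towerObjects`,
`VacuumAndBooking.rmSucc_of_sum_booking` — all generic over `B10.TowerRun`/`SectB.TowerObjects`) are the lane's, BY NAME.  [folklore] bookkeeping;
nothing of [Balaban1985UV3] is asserted.
-/

noncomputable section

namespace Summit.QuantumFields.Balaban3D.Proofs.InputsAC

open MeasureTheory
open Literature.MathematicalPhysics.QuantumFieldTheory.Balaban1983to89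
open Literature.MathematicalPhysics.QuantumFieldTheory.Balaban1983to89.B10
open Literature.MathematicalPhysics.QuantumFieldTheory.Balaban1983to89.B10SectAGathering
open Literature.MathematicalPhysics.QuantumFieldTheory.Balaban1985CMP102
open Literature.MathematicalPhysics.QuantumFieldTheory.Balaban1985CMP102.Setting
open Literature.MathematicalPhysics.QuantumFieldTheory.Balaban1985CMP102.SectB
open Summit.QuantumFields.Balaban3D.Carriers
open Summit.QuantumFields.Balaban3D.Proofs.ScalesArithmetic
open Summit.QuantumFields.Balaban3D.Proofs.EndTheorem
open Summit.QuantumFields.Balaban3D.Proofs.Inputs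
open Summit.QuantumFields.Balaban3D.Proofs.StarCountRun3
open Summit.QuantumFields.Balaban3D.Proofs.TowerAC
open Summit.QuantumFields.Balaban3D.Proofs.SeriesAC
open Summit.QuantumFields.Balaban3D.Proofs.StandardAC

variable {L : ℕ}

/-! ## §1 The AC tower input of the lane, its pinned tower and step pieces -/

section Defs

variable (𝔎 : LaneConsts L) {S : Scales L} {G : Type} [GaugeGroup G] [MeasurableSpace G] [HaarData G]
  {V : Type} [NormedAddCommGroup V] [NormedSpace ℂ V]
  (X : ExternalInputsAC S G) (𝔖 : ∀ k, StepSeries S G V (nblkOf S 𝔎.carrier k) k)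

/-- **THE LANE'S AC TOWER INPUT**: the standard AC tower input `stdTowerInputAC X K 𝔖` at the record's carrier constants `K := 𝔎.carrier`
(seat p3's `inputOf` with `ExternalInputsAC` and uncapped masses). [cite: Balaban1985UV3, (38)–(43) p.266 + (62) p.271] -/
def inputOfAC : TowerInputAC S G := stdTowerInputAC X 𝔎.carrier 𝔖

/-- `inputOfAC` is `towerInputOfAC` at `piecesParamsOf` (definitional). [folklore] -/
theorem inputOfAC_eq : inputOfAC 𝔎 X 𝔖 = towerInputOfAC X 𝔎.carrier 𝔖 (piecesParamsOf S 𝔎.carrier) := rfl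

/-- The pinned AC tower of the lane's AC input as a `B10.TowerRun`. [folklore] -/
abbrev towerOfAC : TowerRun := (inputOfAC 𝔎 X 𝔖).tower3.toTowerRun

/-- **THE STEP PIECES of the lane's AC tower** at step `k` (`SeriesAC.TowerBaseAC.seriesPiecesAC`). [cite: Balaban1985UV3, (55)–(63) pp.269–272] -/
abbrev piecesAC (k : ℕ) : StepPieces (towerOfAC 𝔎 X 𝔖) k :=
  (X.toTowerBase 𝔎.carrier).seriesPiecesAC 𝔖 (piecesParamsOf S 𝔎.carrier) k

end Defs

/-- **THE LANE'S AC TOWER CONSTRUCTION** (`mkT` over AC inputs): `fun G 𝔊 S => towerWith (inputOfAC (𝔎 G 𝔊) (X G 𝔊 S) (𝔖 G 𝔊 S)) ⊤`.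
[cite: Balaban1985UV3, (38)–(43) p.266] -/
def mkTAC (𝔎 : ∀ (G : Type) [GaugeGroup G] [MeasurableSpace G] [HaarData G], GroupModel G → LaneConsts L)
    (𝒱 : ∀ (G : Type) [GaugeGroup G] [MeasurableSpace G] [HaarData G], GroupModel G → ChartSpace)
    (X : ∀ (G : Type) [GaugeGroup G] [MeasurableSpace G] [HaarData G], GroupModel G → ∀ S : Scales L, ExternalInputsAC S G)
    (𝔖 : ∀ (G : Type) [GaugeGroup G] [MeasurableSpace G] [HaarData G] (𝔊 : GroupModel G) (S : Scales L) (k : ℕ),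
      StepSeries S G (𝒱 G 𝔊).V (nblkOf S (𝔎 G 𝔊).carrier k) k) :
    TowerConstruction L :=
  fun G _ _ _ 𝔊 S => (inputOfAC (𝔎 G 𝔊) (X G 𝔊 S) (𝔖 G 𝔊 S)).towerWith fun _ => True

/-! ## §2 The unpinned tower objects and pieces (the shape of `Bound55AC`) and the transfer to the pinned ones -/

section Unpin

variable (𝔎 : LaneConsts L) {S : Scales L} {G : Type} [GaugeGroup G] [MeasurableSpace G] [HaarData G]
  {V : Type} [NormedAddCommGroup V] [NormedSpace ℂ V]
  (X : ExternalInputsAC S G) (𝔖 : ∀ k, StepSeries S G V (nblkOf S 𝔎.carrier k) k)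

/-- The lane's stage-1 AC tower objects `towerWith ⊤` (unpinned; `mkTAC G 𝔊 S` is this, `towerOfAC` is its `pin`). [folklore] -/
abbrev towerWAC : TowerObjects S G := (inputOfAC 𝔎 X 𝔖).towerWith fun _ => True

/-- The AC step pieces read over the UNPINNED tower `towerWAC` (same fields; the shape of `Bound55AC.bound55_of_select`). [folklore] -/
def piecesWAC (k : ℕ) : StepPieces (towerWAC 𝔎 X 𝔖).toTowerRun k where
  proj := (piecesAC 𝔎 X 𝔖 k).proj
  proj_triv := (piecesAC 𝔎 X 𝔖 k).proj_triv
  Zvol := (piecesAC 𝔎 X 𝔖 k).Zvol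
  Zvol_nonneg := (piecesAC 𝔎 X 𝔖 k).Zvol_nonneg
  Zvol_triv := (piecesAC 𝔎 X 𝔖 k).Zvol_triv
  starB := (piecesAC 𝔎 X 𝔖 k).starB
  starT := (piecesAC 𝔎 X 𝔖 k).starT
  logσ₀ := (piecesAC 𝔎 X 𝔖 k).logσ₀
  dg := (piecesAC 𝔎 X 𝔖 k).dg
  dg_nonneg := (piecesAC 𝔎 X 𝔖 k).dg_nonneg
  logZU := (piecesAC 𝔎 X 𝔖 k).logZU
  logZ1 := (piecesAC 𝔎 X 𝔖 k).logZ1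
  logZT := (piecesAC 𝔎 X 𝔖 k).logZT
  logFl := (piecesAC 𝔎 X 𝔖 k).logFl
  PprU := (piecesAC 𝔎 X 𝔖 k).PprU
  Ppr1 := (piecesAC 𝔎 X 𝔖 k).Ppr1
  PprT := (piecesAC 𝔎 X 𝔖 k).PprT
  PY := (piecesAC 𝔎 X 𝔖 k).PY
  PYZ := (piecesAC 𝔎 X 𝔖 k).PYZ
  Pold := (piecesAC 𝔎 X 𝔖 k).Pold
  PoldIn := (piecesAC 𝔎 X 𝔖 k).PoldIn
  rem := (piecesAC 𝔎 X 𝔖 k).rem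
  rem_nonneg := (piecesAC 𝔎 X 𝔖 k).rem_nonneg

/-- **(22)/(55) TRANSPORTS FROM THE UNPINNED TO THE PINNED AC TOWER**: `Bound55` for `piecesWAC` gives `Bound55` for `piecesAC` ((41)_k through
`SectB.TowerObjects.ineq41_pin_iff`, `ρ_{k+1}` through `pin_rho`). [cite: Balaban1985UV3, (55) p.269] -/
theorem bound55_piecesAC_of_unpinned (k : ℕ) (h : Bound55 (piecesWAC 𝔎 X 𝔖 k)) : Bound55 (piecesAC 𝔎 X 𝔖 k) := by
  intro h41 U
  have hb := h (((towerWAC 𝔎 X 𝔖).ineq41_pin_iff k).mp h41) U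
  have hρ : (towerOfAC 𝔎 X 𝔖).ρ (k + 1) U = (towerWAC 𝔎 X 𝔖).toTowerRun.ρ (k + 1) U :=
    congrFun ((towerWAC 𝔎 X 𝔖).pin_rho (k + 1)) U
  rw [hρ]
  exact hb

/-- The lower twin transports likewise ((47)_k through `ineq47_pin_iff`). [cite: Balaban1985UV3, (47) p.267 + p.272 L32–33] -/
theorem bound55Lower_piecesAC_of_unpinned (k : ℕ) (h : Bound55Lower (piecesWAC 𝔎 X 𝔖 k)) : Bound55Lower (piecesAC 𝔎 X 𝔖 k) := by
  intro h47 U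
  have hb := h (((towerWAC 𝔎 X 𝔖).ineq47_pin_iff k).mp h47) U
  have hρ : (towerOfAC 𝔎 X 𝔖).ρ (k + 1) U = (towerWAC 𝔎 X 𝔖).toTowerRun.ρ (k + 1) U :=
    congrFun ((towerWAC 𝔎 X 𝔖).pin_rho (k + 1)) U
  rw [hρ]
  exact hb

end Unpin

/-! ## §3 The bookkeeping step leaves at the AC pieces: star count, Z-term booking, remainder booking; `SpecOK`, `NoInteraction0` -/

section StepBookkeeping

variable (𝔎 : LaneConsts L) {S : Scales L} {G : Type} [GaugeGroup G] [MeasurableSpace G] [HaarData G]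
  {V : Type} [NormedAddCommGroup V] [NormedSpace ℂ V]
  (X : ExternalInputsAC S G) (𝔖 : ∀ k, StepSeries S G V (nblkOf S 𝔎.carrier k) k) (k : ℕ)

/-- **Row C9 `starCount` AT THE AC PIECES, `c₁ = 3`** (seat p3's `StarCountRun3.starCount_leaf_run3`, every identification `rfl`). [cite: Balaban1985UV3, p.265 L8–9 + p.271 L13] -/
theorem starCount_piecesAC (hk : k + 1 ≤ S.K) : StarCount (piecesAC 𝔎 X 𝔖 k) 3 :=
  starCount_leaf_run3 (P := S.P) rfl 𝔎.F.M₁ (rcolOf S 𝔎.carrier) (by show k + 1 ≤ S.m + S.K; omega) rfl (piecesAC 𝔎 X 𝔖 k) rfl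
    (fun _ => rfl) (fun _ => le_rfl)

/-- **Row C13 `ztermSucc` AT THE AC PIECES** (seat p5's `Run3Zterm.ztermSucc_towerObjects`; the history projection keeps the recorded `|Z_j|`,
`TowerAC.TowerInputAC.towerWith_Zvol_proj`). [cite: Balaban1985UV3, (41) p.266 + p.271 L13] -/
theorem ztermSucc_piecesAC :
    ZtermSucc (piecesAC 𝔎 X 𝔖 k) ((𝔎.sc.Cz + 𝔎.sc.Cv) * (towerOfAC 𝔎 X 𝔖).g k + 𝔎.sc.C₅ + 𝔎.sc.C₆
      + (|(piecesAC 𝔎 X 𝔖 k).logσ₀| + (piecesAC 𝔎 X 𝔖 k).dg * Real.log ((towerOfAC 𝔎 X 𝔖).g k)⁻¹) * 3) :=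
  ztermSucc_towerObjects (inputOfAC 𝔎 X 𝔖).tower3 (piecesAC 𝔎 X 𝔖 k)
    (fun h j hj => by
      show ((inputOfAC 𝔎 X 𝔖).towerWith fun _ => True).Zvol k (Hist.proj h) j
        = ((inputOfAC 𝔎 X 𝔖).towerWith fun _ => True).Zvol (k + 1) h j
      exact (inputOfAC 𝔎 X 𝔖).towerWith_Zvol_proj _ k h j hj)
    (fun _ => rfl) le_rfl

/-- **Row C14 `rmSucc` AT THE AC PIECES** (seat p6's `VacuumAndBooking.rmSucc_of_sum_booking` with equality; `rcoefOf` books `rstar·g^{6+2κ₀}`).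
[cite: Balaban1985UV3, (41) p.266] -/
theorem rmSucc_piecesAC :
    RmSucc (piecesAC 𝔎 X 𝔖 k) (max 𝔎.sc.C₁ 𝔎.sc.C₁' + 𝔎.sc.C₂ + 𝔎.sc.C₃ + 𝔎.sc.C₄) := by
  refine VacuumAndBooking.rmSucc_of_sum_booking (piecesAC 𝔎 X 𝔖 k)
    (fun j => (inputOfAC 𝔎 X 𝔖).rcoef j * ((L : ℝ) ^ j * S.ε) ^ (3 + (inputOfAC 𝔎 X 𝔖).κ₀) * S.sites j) _ (fun _ => rfl)
    (le_of_eq ?_)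
  show 𝔎.sc.rstar * ((S.gk k ^ 2) ^ (3 + 𝔎.F.κ₀) * S.sites k)
    = rcoefOf S 𝔎.carrier k * ((L : ℝ) ^ k * S.ε) ^ (3 + 𝔎.F.κ₀) * S.sites k
  rw [rcoefOf_carrier, gk_sq_rpow]
  show 𝔎.sc.rstar * ((S.g ^ 2) ^ (3 + 𝔎.F.κ₀) * ((L : ℝ) ^ k * S.ε) ^ (3 + 𝔎.F.κ₀) * S.sites k)
    = 𝔎.sc.rstar * (S.g ^ 2) ^ (3 + 𝔎.F.κ₀) * ((L : ℝ) ^ k * S.ε) ^ (3 + 𝔎.F.κ₀) * S.sites k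
  ring

/-- **`SpecOK` for the lane's AC tower**: «ρ_k satisfies (41), (47)» IS the typed `B10.Ineq41 ∧ B10.Ineq47` (spine's `specOK_pin`). [cite: Balaban1985UV3, Thm 2 p.272] -/
theorem specOK_towerOfAC : SpecOK (towerOfAC 𝔎 X 𝔖) := TowerObjects.specOK_pin (towerWAC 𝔎 X 𝔖)

/-- **No interaction at `k = 0`** for the lane's AC tower (`Pint 0 = 0`, LQB `B10LargeField.NoInteraction0`, `rfl`). [cite: Balaban1985UV3, (1) p.256] -/
theorem noInteraction0_towerOfAC : B10LargeField.NoInteraction0 (towerOfAC 𝔎 X 𝔖) := fun _ _ => rfl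

/-- `ε₁(k) = g_k·p(g_k) > 0` for the lane's AC input, `k ≤ K`. [cite: Balaban1985UV3, (7) p.257] -/
theorem eps1_inputOfAC_pos (hk : k ≤ S.K) : 0 < (inputOfAC 𝔎 X 𝔖).ε₁ k := by
  show 0 < S.gk k * pFun 𝔎.F.b₀ 𝔎.F.p₀ (S.gk k)
  have hu : 0 < 1 + Real.log (S.gk k)⁻¹ := by
    have := log_inv_nonneg_of_le_one (gk_pos S k) (gk_le_one S S.gK_le_one k hk); linarith
  exact mul_pos (gk_pos S k) (mul_pos 𝔎.F.b₀_pos (Real.rpow_pos_of_pos hu _))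

end StepBookkeeping

end Summit.QuantumFields.Balaban3D.Proofs.InputsAC

end
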